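import Summits.HubbardSuperconductivity.HubbardSuperconductivity.Theses.BcsKacWindow
import Summits.HubbardSuperconductivity.HubbardSuperconductivity.Theorems.BcsKacWindowInfraredCompletionSqrtShape

/-!
# Skeleton v5 (lead c15) for crux `InfraredCompletion` (stmt-HubbardSuperconductivity-1321) — line `birth`

Lead: `prover-line-stmt-HubbardSuperconductivity-1321-c15-0` (2026-08-17). v5 RESHAPES the phase-coherence stub
of v4 (lead c14): stub A `stub_softWindowFloor` is byte-identical to v3/v4; stub B2' `stub_goldstoneShapeBg`
(pointwise RELATIVE Goldstone shape `S(m)|q_m|L² ≤ A·S(0) + B|q_m|L²`, Goldstone coefficient ∝ condensate) is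
REPLACED by the weaker stub B3 `stub_sqrtGoldstoneShape` (the "sqrt-shape"
`S(m)|q_m|L² ≤ A·L·√S(0) + D·Δ(U)·L² + B|q_m|L²`, Goldstone coefficient ∝ √condensate — the geometric mean of
the relative and the absolute infrared bound). The composition still closes the crux because the soft window
has radius `Δ(U)/t`: with `x = S(0)`, `window sum = x + tail ≥ c_A Δ² L²` (floor) and
`tail ≤ (2AΔL/t)√x + 2DΔ²L²/t + BΔ²L²/t²`, which is incompatible with `x < c_A Δ² L²/4` once
`t ≥ max(1, 64A²/c_A + 16D/c_A + 8B/c_A)` — the zero-mode BOOTSTRAP, landed `sorry`-free as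
`Theorems/BcsKacWindowInfraredCompletionSqrtShape.lean` (p153232, `infraredCompletion_of_floor_of_sqrtShape`,
`c₁ = c_A/4`). B2' ⇒ B3 (`Theorems/BcsKacWindowInfraredCompletionSqrtShapeOfShapeBg.lean`,
`sqrtShape_of_shapeBg`, via the Parseval ceiling `S(0) ≤ 32L²`), so v5 asks for no more than v4, and the v4
reduction factors through v5.

Why the sqrt-shape is the right phase stub (see `PICKED.md` / lead NOTES): it is exactly the output of the
`T = 0` uncertainty (Pitaevskii–Stringari / moment) method `‖Δ_d(q)ψ‖² ≤ √(χ_pair(q)·f(q))` fed with an f-sum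
(double-commutator) bound `f = O(L²)` and a RELATIVE pair-susceptibility bound `χ_pair(q)|q|² ≲ S(0)/ρ₀ + bg`
(phase stiffness) — the engine landed for the sibling cruxes `WindowInfraredBound` / `WcbcsSsbToTorusLRO`
(`goldstoneShape_of_momentClosure`). CAVEAT recorded by c15: for THIS crux (U → 0) that engine cannot supply
U-uniform constants, because the amplitude channel is soft at weak coupling (`χ_amp ≈ 1/V_eff ~ U⁻²`, so the
moment method's background is `√(f·χ_amp)/L² ~ U⁻¹`), while the bootstrap tolerates a background `B` only up to
`B ≤ c_A t²/8` with `t` fixed before `U`. So B3 must be certified with its TRUE `O(1)` background — it remains the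
`d = 2`, `T = 0` infrared problem, now in its weakest sufficient pointwise form.

Open content of the crux on this line:
* Stub A `stub_softWindowFloor` — soft-window FLOOR on all bulk tori (SIZE TRANSFER; necessary for the crux,
  `Theorems/BcsKacWindowInfraredCompletionNecessity.lean`; handed back by c14 `promote-stub`).
* Stub B3 `stub_sqrtGoldstoneShape` — sqrt-shape on the soft window (PHASE COHERENCE with `O(√order)` Goldstone
  coefficient and U-uniform background).

Composition: `InfraredCompletion_of` = `infraredCompletion_of_floor_of_sqrtShape` applied to the two stubs BY NAME.

Landed around this skeleton (all `--supports`, `Theorems/BcsKacWindowInfraredCompletion*.lean`): `…SqrtShape` (the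
bootstrap, p153232) · `…SqrtShapeOfShapeBg` (B2' ⇒ B3, p153585) · `…ZeroModeWindow` (below `L < 2πt/Δ` the soft window is
`{0}`: stub A's floor IS the crux conclusion there, p154761) · `…VolumeMonotone` (stub A ⇐ W ∧ hVM, the error-free
Griffiths-in-volume heredity of coarse-grained pair weight = the named atom of A, p154802) · `…RelStiffnessEngine` (B3 ⇐
relative variational pair stiffness ∧ charging floor, pointwise, via the sibling crux's moment-method engine, p155114) ·
`…BlochReduction(Stubs)` (A, B3 and the crux need only be proved for translation- and `spinSq`-eigen ground states,
p154991/p155388) · earlier `…Reduction`, `…Necessity`, `…SoftWindowTail(Bg)` (c13/c14).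
See `Lines/birth.md` for the planner's line card (v1) and `PICKED.md` for the lead history and the c15 engine barrier.
Namespace `Summit.HubbardSuperconductivity.HubbardSuperconductivity.Cruxes.InfraredCompletion.Birth`.
-/

noncomputable section

set_option linter.dupNamespace false

open scoped Classical Matrix BigOperators

namespace Summit.HubbardSuperconductivity.HubbardSuperconductivity.Cruxes.InfraredCompletion.Birth

open Literature.MathematicalPhysics.QuantumLattice Literature.Probability.LatticeModels
open Summit.HubbardSuperconductivity.HubbardSuperconductivity.Theses.BcsKacWindow
open Summit.HubbardSuperconductivity.HubbardSuperconductivity.Theorems.InfraredCompletion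
  (infraredCompletion_of_floor_of_sqrtShape)

/-! ### The two stubs (registered: A byte-identical to v3/v4, B3 new in v5) -/

/-- **Stub A — soft-window floor (amplitude half; coarse-grained local order persists in bulk tori).**
Under the crux's antecedent (guards, flat pin, coherence-window bound): there are `c_A > 0`, `s_A`
such that for every window parameter `t ≥ s_A` some `U_A > 0` gives, for all `δ ∈ [a,b]`,
`U ∈ (0,U_A)`, even `L` with `t ≤ Δ(U)·L` and every normalised sector ground state `ψ`,
`c_A Δ(U)² L² ≤ Σ_{m : |q_m|² ≤ (Δ(U)/t)²} S_ψ(m)`. [conjectural step] -/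
theorem stub_softWindowFloor :
    ∀ (a b κ₁ κ₂ c₀ s₀ : ℝ) (Δ : ℝ → ℝ), 0 < a → a < b → b < 1 / 2 → 0 < κ₁ → κ₁ ≤ κ₂ → 0 < c₀ →
      0 < s₀ → (∀ U : ℝ, 0 < U → Real.exp (-(κ₂ / U ^ 2)) ≤ Δ U ∧ Δ U ≤ Real.exp (-(κ₁ / U ^ 2))) →
      (∀ s : ℝ, s₀ ≤ s → ∃ U₁ : ℝ, 0 < U₁ ∧ ∀ δ ∈ Set.Icc a b, ∀ U ∈ Set.Ioo (0:ℝ) U₁,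
        ∀ (L : ℕ) [NeZero L], Even L → s₀ ≤ Δ U * L → Δ U * L ≤ s →
          ∀ ψ : Fock (Orb (FermionTorus 2 L)), star ψ ⬝ᵥ ψ = 1 →
            IsGroundStateInSector (hubbardTorus 2 L 1 U) (2 * ⌊(1 - δ) * (L : ℝ) ^ 2 / 2⌋₊) 0 ψ →
              c₀ * Δ U ^ 2 ≤ (expect ((pairField dWaveFormFactor L)ᴴ * pairField dWaveFormFactor L)
                ψ).re / (L : ℝ) ^ 4) →
      ∃ cA sA : ℝ, 0 < cA ∧ ∀ t : ℝ, sA ≤ t → ∃ UA : ℝ, 0 < UA ∧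
        ∀ δ ∈ Set.Icc a b, ∀ U ∈ Set.Ioo (0:ℝ) UA, ∀ (L : ℕ) [NeZero L], Even L → t ≤ Δ U * L →
          ∀ ψ : Fock (Orb (FermionTorus 2 L)), star ψ ⬝ᵥ ψ = 1 →
            IsGroundStateInSector (hubbardTorus 2 L 1 U) (2 * ⌊(1 - δ) * (L : ℝ) ^ 2 / 2⌋₊) 0 ψ →
              cA * Δ U ^ 2 * (L : ℝ) ^ 2 ≤
                ∑ m ∈ Finset.univ.filter
                    (fun m : Fin 2 → ZMod L => momentumNormSq L m ≤ (Δ U / t) ^ 2),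
                  pairStructureFactor dWaveFormFactor L ψ m := by
  sorry

/-- **Stub B3 — sqrt-shape on the soft window (phase-coherence half; held by the lead).** Under the
crux's antecedent (guards, flat pin, coherence-window bound): there are `A, D, B ≥ 0`, `t₀ > 0` and
`U_R > 0` such that for all `δ ∈ [a,b]`, `U ∈ (0,U_R)`, every even `L` with `t₀ ≤ Δ(U)·L`, every
normalised sector ground state `ψ` and every NONZERO label `m` with `|q_m|² ≤ (Δ(U)/t₀)²`:
`S_ψ(m) · |q_m| · L² ≤ A · L · √(S_ψ(0)) + D · Δ(U) · L² + B · |q_m| · L²`, i.e.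
`S_ψ(m) · |q_m| ≤ A · √(order) + D · Δ(U) + B · |q_m|` with `order = S_ψ(0)/L² = Re⟨Δ_d†Δ_d⟩/L⁴`
(`S_ψ = pairStructureFactor dWaveFormFactor L ψ`, `|q_m| = √(momentumNormSq L m)`). Informally: below
the inverse coherence-window scale the pair structure factor of a ground state is at most a `|q|⁻¹`
Goldstone singularity whose coefficient is `O(√order)` (any engine pairing a phase-stiffness floor
`ρ_s ≥ ρ₀ > 0` with the f-sum gives `A ≈ √(f/ρ₀)`), plus an `O(Δ(U))` absolute part, plus a flat
incoherent background `B ≈ sup S_bg`, ALL UNIFORM IN `U` — zero-mode dominance up to background on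
the window `|q| ≤ Δ(U)/t`, `t → ∞`. Weaker than v4's relative shape B2' (`sqrtShape_of_shapeBg`).
[conjectural step] -/
theorem stub_sqrtGoldstoneShape :
    ∀ (a b κ₁ κ₂ c₀ s₀ : ℝ) (Δ : ℝ → ℝ), 0 < a → a < b → b < 1 / 2 → 0 < κ₁ → κ₁ ≤ κ₂ → 0 < c₀ →
      0 < s₀ → (∀ U : ℝ, 0 < U → Real.exp (-(κ₂ / U ^ 2)) ≤ Δ U ∧ Δ U ≤ Real.exp (-(κ₁ / U ^ 2))) →
      (∀ s : ℝ, s₀ ≤ s → ∃ U₁ : ℝ, 0 < U₁ ∧ ∀ δ ∈ Set.Icc a b, ∀ U ∈ Set.Ioo (0:ℝ) U₁,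
        ∀ (L : ℕ) [NeZero L], Even L → s₀ ≤ Δ U * L → Δ U * L ≤ s →
          ∀ ψ : Fock (Orb (FermionTorus 2 L)), star ψ ⬝ᵥ ψ = 1 →
            IsGroundStateInSector (hubbardTorus 2 L 1 U) (2 * ⌊(1 - δ) * (L : ℝ) ^ 2 / 2⌋₊) 0 ψ →
              c₀ * Δ U ^ 2 ≤ (expect ((pairField dWaveFormFactor L)ᴴ * pairField dWaveFormFactor L)
                ψ).re / (L : ℝ) ^ 4) →
      ∃ A D B t₀ UR : ℝ, 0 ≤ A ∧ 0 ≤ D ∧ 0 ≤ B ∧ 0 < t₀ ∧ 0 < UR ∧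
        ∀ δ ∈ Set.Icc a b, ∀ U ∈ Set.Ioo (0:ℝ) UR, ∀ (L : ℕ) [NeZero L], Even L → t₀ ≤ Δ U * L →
          ∀ ψ : Fock (Orb (FermionTorus 2 L)), star ψ ⬝ᵥ ψ = 1 →
            IsGroundStateInSector (hubbardTorus 2 L 1 U) (2 * ⌊(1 - δ) * (L : ℝ) ^ 2 / 2⌋₊) 0 ψ →
              ∀ m : Fin 2 → ZMod L, m ≠ 0 → momentumNormSq L m ≤ (Δ U / t₀) ^ 2 →
                pairStructureFactor dWaveFormFactor L ψ m * Real.sqrt (momentumNormSq L m) *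
                    (L : ℝ) ^ 2 ≤
                  A * (L : ℝ) * Real.sqrt (pairStructureFactor dWaveFormFactor L ψ 0) +
                    D * Δ U * (L : ℝ) ^ 2 +
                      B * Real.sqrt (momentumNormSq L m) * (L : ℝ) ^ 2 := by
  sorry

/-! ### The composition -/

/-- **Composition, registered form**: the crux `InfraredCompletion` BY NAME from the two stubs BY NAME, through the
landed `sorry`-free reduction `infraredCompletion_of_floor_of_sqrtShape` (p153232): for each datum stub A gives the
floor, stub B3 the sqrt-shape, the flat pin gives `Δ(U) > 0`, and the zero-mode bootstrap `bulk_of_floor_of_sqrtShape`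
concludes (`c₁ = c_A/4`). [folklore: Kennedy–Lieb–Shastry, PRL 61 (1988) 2582 — sum rule minus infrared bound;
Pitaevskii–Stringari, JLTP 85 (1991) 377 — why an `O(√order)` coefficient is the natural target] -/
theorem InfraredCompletion_of : InfraredCompletion :=
  infraredCompletion_of_floor_of_sqrtShape stub_softWindowFloor stub_sqrtGoldstoneShape

end Summit.HubbardSuperconductivity.HubbardSuperconductivity.Cruxes.InfraredCompletion.Birth

end
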